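import Summits.Ventures.LatticeQCDFlow.Scaling.GroundStateShape

/-!
HONEST FRAMING: exact (Metropolis-corrected) sampling algorithms for lattice gauge theory; figures
of merit are autocorrelation/cost numbers at stated couplings and volumes; no continuum-physics
claim.

# LadderGroundStateProfile — A PENDANT SET IS FED THROUGH ONE PAIR: `(t/m)·n_{ab}·(c_b − c_a) = ρ·Σ_{A}c` WHEN EVERY LISTED PAIR LEAVING `A ∌ 0` IS A COPY OF `{a, b}`; ON THE LADDER
# THE GROUND STATE IS STRICTLY INCREASING AND CONCAVE AWAY FROM THE HOT SEAT: `(t/K)(c_{k+1} − c_k) = ρ·Σ_{j>k}c_j`, `c_1 − c_0 = (K/t)(h − ρ)c_0 ≥ c_2 − c_1 ≥ ⋯ ≥ c_K − c_{K−1} > 0`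
# (lean-2 GEN-48, ours)

Venture-side (OURS).  Cell `lqcd-flow` (pub-lqcd), unit `pub-lqcd-lean-2-g48`, 2026-09-01.  Chapter AI (the sizes of the Robin ground state), file 12 — Mathlib only (through file 2).  (§1) File 1's
flux identity on a set `A ∌ 0` whose boundary in the list consists of copies of one pair `{a, b}` (`b ∈ A`, `a ∉ A`): every crossing term is `c_b − c_a`, every other term vanishes, so
`(t/m)·#copies·(c_b − c_a) = ρΣ_Ac`; for a positive solution with `ρ > 0` the inner endpoint is STRICTLY LARGER — the ground state increases across every bridge away from the hot seat (trees:
along every branch).  (§2) THE LADDER `e_j = (j, j+1)` (`m = K`): the tail `{j : j ≥ k+1}` is pendant through `(k, k+1)` alone, so `(t/K)(c_{k+1} − c_k) = ρΣ_{j≥k+1}c_j` — the profile is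
strictly increasing (`c_0 < c_1 < ⋯ < c_K`: in the slowest mode the colder replicas carry the larger weights), its increments are non-increasing (CONCAVITY: the tails shrink), and the first
increment is `c_1 − c_0 = (K/t)(h − ρ)c_0` by the trace identity, whence `c_k ≤ (1 + k·K(h−ρ)/t)·c_0` (file 2's chain bound with the exact first step).  No definitions; no Markov chain.

* §1 `indicator_diff_of_not_cross`, `groundState_pendant_flux`, `groundState_pendant_lt`; §2 `ladder_tail_cross_iff`, `ladder_increment_eq`, `ladder_strictMono_step`, `ladder_increment_antitone`,
  `ladder_first_increment`, `ladder_le_linear`.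

Literature grade (cell rule): ELEMENTARY, NEW TYPING; nothing cited; no new bib keys.
-/

noncomputable section

open Finset

namespace Summit.Ventures.LatticeQCDFlow.Scaling

section Pendant
variable {K m : ℕ} (e : Fin m → Fin (K + 1) × Fin (K + 1)) {t h ρ : ℝ} {c : Fin (K + 1) → ℝ}

/-! ## §1 Pendant sets -/

omit e in
/-- A pair that does not cross `A` contributes nothing to the flux: both endpoints in or both out. [ours] -/
theorem indicator_diff_of_not_cross {A : Finset (Fin (K + 1))} {i l : Fin (K + 1)} (hnc : ¬((i ∈ A ∧ l ∉ A) ∨ (l ∈ A ∧ i ∉ A))) :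
    ((if i ∈ A then (1 : ℝ) else 0) - (if l ∈ A then (1 : ℝ) else 0)) = 0 := by
  push Not at hnc
  by_cases hi : i ∈ A <;> by_cases hl : l ∈ A
  · rw [if_pos hi, if_pos hl, sub_self]
  · exact absurd hl (not_not.mpr (hnc.1 hi))
  · exact absurd hi (not_not.mpr (hnc.2 hl))
  · rw [if_neg hi, if_neg hl, sub_self]

/-- **THE PENDANT FLUX:** `0 ∉ A`, `b ∈ A`, `a ∉ A`, and every listed pair crossing `A` is a copy of `{a, b}` ⇒ **`(t/m)·#{copies of {a,b}}·(c_b − c_a) = ρ·Σ_{k∈A}c_k`**. [ours] -/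
theorem groundState_pendant_flux
    (hvertex : ∀ k : Fin (K + 1), t / m * ∑ r : Fin m, ((if k = (e r).1 then c (e r).2 - c (e r).1 else 0) + (if k = (e r).2 then c (e r).1 - c (e r).2 else 0))
      - (if k = 0 then h * c k else 0) = -ρ * c k)
    {A : Finset (Fin (K + 1))} (h0 : (0 : Fin (K + 1)) ∉ A) {a b : Fin (K + 1)} (hb : b ∈ A) (ha : a ∉ A)
    (hcross : ∀ r : Fin m, (((e r).1 ∈ A ∧ (e r).2 ∉ A) ∨ ((e r).2 ∈ A ∧ (e r).1 ∉ A)) → (((e r).1 = a ∧ (e r).2 = b) ∨ ((e r).1 = b ∧ (e r).2 = a))) :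
    t / m * ((univ.filter fun r : Fin m => ((e r).1 = a ∧ (e r).2 = b) ∨ ((e r).1 = b ∧ (e r).2 = a)).card : ℝ) * (c b - c a) = ρ * ∑ k ∈ A, c k := by
  classical
  have hflux := groundState_flux e hvertex A
  rw [if_neg h0, add_zero] at hflux
  have hab : a ≠ b := fun h' => ha (h' ▸ hb)
  -- each term is `c_b − c_a` on a copy, `0` otherwise
  have hterm : ∀ r : Fin m, (c (e r).1 - c (e r).2) * ((if (e r).1 ∈ A then (1 : ℝ) else 0) - (if (e r).2 ∈ A then (1 : ℝ) else 0))
      = if (((e r).1 = a ∧ (e r).2 = b) ∨ ((e r).1 = b ∧ (e r).2 = a)) then (c b - c a) else 0 := by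
    intro r
    by_cases hcopy : ((e r).1 = a ∧ (e r).2 = b) ∨ ((e r).1 = b ∧ (e r).2 = a)
    · rw [if_pos hcopy]
      rcases hcopy with ⟨h1, h2⟩ | ⟨h1, h2⟩
      · rw [h1, h2, if_neg ha, if_pos hb]; ring
      · rw [h1, h2, if_pos hb, if_neg ha]; ring
    · rw [if_neg hcopy]
      have hnc : ¬(((e r).1 ∈ A ∧ (e r).2 ∉ A) ∨ ((e r).2 ∈ A ∧ (e r).1 ∉ A)) := fun hc => hcopy (hcross r hc)
      rw [indicator_diff_of_not_cross hnc, mul_zero]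
  simp_rw [hterm] at hflux
  rw [← sum_filter, sum_const, nsmul_eq_mul] at hflux
  rw [← hflux]; ring

/-- **ACROSS A BRIDGE AWAY FROM THE HOT SEAT THE GROUND STATE INCREASES:** under the pendant hypotheses with at least one copy, `c > 0`, `ρ > 0`, `t > 0`, `m ≥ 1`: `c_a < c_b`, and
`c_b − c_a = (m/(t·#copies))·ρ·Σ_{A}c`. [ours] -/
theorem groundState_pendant_lt (hm : 1 ≤ m) (ht : 0 < t) (hρ : 0 < ρ) (hc : ∀ k, 0 < c k)
    (hvertex : ∀ k : Fin (K + 1), t / m * ∑ r : Fin m, ((if k = (e r).1 then c (e r).2 - c (e r).1 else 0) + (if k = (e r).2 then c (e r).1 - c (e r).2 else 0))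
      - (if k = 0 then h * c k else 0) = -ρ * c k)
    {A : Finset (Fin (K + 1))} (h0 : (0 : Fin (K + 1)) ∉ A) {a b : Fin (K + 1)} (hb : b ∈ A) (ha : a ∉ A)
    (hcross : ∀ r : Fin m, (((e r).1 ∈ A ∧ (e r).2 ∉ A) ∨ ((e r).2 ∈ A ∧ (e r).1 ∉ A)) → (((e r).1 = a ∧ (e r).2 = b) ∨ ((e r).1 = b ∧ (e r).2 = a)))
    (hcopy : 1 ≤ (univ.filter fun r : Fin m => ((e r).1 = a ∧ (e r).2 = b) ∨ ((e r).1 = b ∧ (e r).2 = a)).card) :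
    c a < c b ∧ c b - c a = m / (t * ((univ.filter fun r : Fin m => ((e r).1 = a ∧ (e r).2 = b) ∨ ((e r).1 = b ∧ (e r).2 = a)).card : ℝ)) * (ρ * ∑ k ∈ A, c k) := by
  classical
  have hmpos : (0 : ℝ) < m := Nat.cast_pos.mpr (by omega)
  have hnpos : (0 : ℝ) < ((univ.filter fun r : Fin m => ((e r).1 = a ∧ (e r).2 = b) ∨ ((e r).1 = b ∧ (e r).2 = a)).card : ℝ) := Nat.cast_pos.mpr (by omega)
  have hflux := groundState_pendant_flux e hvertex h0 hb ha hcross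
  have hA : 0 < ∑ k ∈ A, c k := lt_of_lt_of_le (hc b) (Finset.single_le_sum (fun k _ => (hc k).le) hb)
  have heq : c b - c a = m / (t * ((univ.filter fun r : Fin m => ((e r).1 = a ∧ (e r).2 = b) ∨ ((e r).1 = b ∧ (e r).2 = a)).card : ℝ)) * (ρ * ∑ k ∈ A, c k) := by
    rw [← hflux]; field_simp
  refine ⟨?_, heq⟩
  have : 0 < c b - c a := by rw [heq]; positivity
  linarith

end Pendant

/-! ## §2 The ladder -/

section Ladder
variable {K : ℕ} {t h ρ : ℝ} {c : Fin (K + 1) → ℝ}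

/-- On the ladder, the pair `(j, j+1)` crosses the tail `{i : k+1 ≤ i}` iff `j = k`. [ours] -/
theorem ladder_tail_cross_iff (k j : Fin K) :
    (((j.castSucc : Fin (K + 1)) ∈ (univ.filter fun i : Fin (K + 1) => k.succ ≤ i) ∧ (j.succ : Fin (K + 1)) ∉ (univ.filter fun i : Fin (K + 1) => k.succ ≤ i))
      ∨ ((j.succ : Fin (K + 1)) ∈ (univ.filter fun i : Fin (K + 1) => k.succ ≤ i) ∧ (j.castSucc : Fin (K + 1)) ∉ (univ.filter fun i : Fin (K + 1) => k.succ ≤ i)))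
      ↔ j = k := by
  simp only [mem_filter, mem_univ, true_and, Fin.le_def, Fin.val_succ, Fin.val_castSucc, Fin.ext_iff]
  omega

/-- **THE LADDER'S INCREMENTS ARE TAIL MASSES: `(t/K)·(c_{k+1} − c_k) = ρ·Σ_{i ≥ k+1}c_i`** for any solution of the adjacent list's vertex equations. [ours] -/
theorem ladder_increment_eq
    (hvertex : ∀ i : Fin (K + 1), t / K * ∑ r : Fin K, ((if i = ((fun j : Fin K => ((j.castSucc, j.succ) : Fin (K + 1) × Fin (K + 1))) r).1
        then c ((fun j : Fin K => ((j.castSucc, j.succ) : Fin (K + 1) × Fin (K + 1))) r).2 - c ((fun j : Fin K => ((j.castSucc, j.succ) : Fin (K + 1) × Fin (K + 1))) r).1 else 0)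
      + (if i = ((fun j : Fin K => ((j.castSucc, j.succ) : Fin (K + 1) × Fin (K + 1))) r).2
        then c ((fun j : Fin K => ((j.castSucc, j.succ) : Fin (K + 1) × Fin (K + 1))) r).1 - c ((fun j : Fin K => ((j.castSucc, j.succ) : Fin (K + 1) × Fin (K + 1))) r).2 else 0))
      - (if i = 0 then h * c i else 0) = -ρ * c i) (k : Fin K) :
    t / K * (c k.succ - c k.castSucc) = ρ * ∑ i ∈ univ.filter (fun i : Fin (K + 1) => k.succ ≤ i), c i := by
  classical
  have h0 : (0 : Fin (K + 1)) ∉ univ.filter (fun i : Fin (K + 1) => k.succ ≤ i) := by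
    rw [mem_filter]; push Not; intro; exact Fin.succ_pos k
  have hb : (k.succ : Fin (K + 1)) ∈ univ.filter (fun i : Fin (K + 1) => k.succ ≤ i) := by rw [mem_filter]; exact ⟨mem_univ _, le_rfl⟩
  have ha : (k.castSucc : Fin (K + 1)) ∉ univ.filter (fun i : Fin (K + 1) => k.succ ≤ i) := by
    rw [mem_filter]; push Not; intro; exact Fin.castSucc_lt_succ
  have hcross : ∀ r : Fin K, ((((fun j : Fin K => ((j.castSucc, j.succ) : Fin (K + 1) × Fin (K + 1))) r).1 ∈ univ.filter (fun i : Fin (K + 1) => k.succ ≤ i)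
        ∧ ((fun j : Fin K => ((j.castSucc, j.succ) : Fin (K + 1) × Fin (K + 1))) r).2 ∉ univ.filter (fun i : Fin (K + 1) => k.succ ≤ i))
      ∨ (((fun j : Fin K => ((j.castSucc, j.succ) : Fin (K + 1) × Fin (K + 1))) r).2 ∈ univ.filter (fun i : Fin (K + 1) => k.succ ≤ i)
        ∧ ((fun j : Fin K => ((j.castSucc, j.succ) : Fin (K + 1) × Fin (K + 1))) r).1 ∉ univ.filter (fun i : Fin (K + 1) => k.succ ≤ i)))
      → ((((fun j : Fin K => ((j.castSucc, j.succ) : Fin (K + 1) × Fin (K + 1))) r).1 = k.castSucc ∧ ((fun j : Fin K => ((j.castSucc, j.succ) : Fin (K + 1) × Fin (K + 1))) r).2 = k.succ)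
        ∨ (((fun j : Fin K => ((j.castSucc, j.succ) : Fin (K + 1) × Fin (K + 1))) r).1 = k.succ ∧ ((fun j : Fin K => ((j.castSucc, j.succ) : Fin (K + 1) × Fin (K + 1))) r).2 = k.castSucc)) := by
    intro r hr
    have hrk : r = k := (ladder_tail_cross_iff k r).mp hr
    left; rw [hrk]; exact ⟨rfl, rfl⟩
  have hflux := groundState_pendant_flux (fun j : Fin K => ((j.castSucc, j.succ) : Fin (K + 1) × Fin (K + 1))) hvertex h0 hb ha hcross
  -- exactly one copy: `r = k`
  have hcard : (univ.filter fun r : Fin K => (((fun j : Fin K => ((j.castSucc, j.succ) : Fin (K + 1) × Fin (K + 1))) r).1 = k.castSucc ∧ ((fun j : Fin K => ((j.castSucc, j.succ) : Fin (K + 1) × Fin (K + 1))) r).2 = k.succ)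
      ∨ (((fun j : Fin K => ((j.castSucc, j.succ) : Fin (K + 1) × Fin (K + 1))) r).1 = k.succ ∧ ((fun j : Fin K => ((j.castSucc, j.succ) : Fin (K + 1) × Fin (K + 1))) r).2 = k.castSucc)).card = 1 := by
    rw [card_eq_one]
    refine ⟨k, ?_⟩
    ext r
    simp only [mem_filter, mem_univ, true_and, mem_singleton]
    constructor
    · intro hr
      rcases hr with ⟨h1, _⟩ | ⟨h1, h2⟩
      · exact Fin.castSucc_injective K h1
      · exfalso
        have e1 := congrArg Fin.val h1
        have e2 := congrArg Fin.val h2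
        rw [Fin.val_castSucc, Fin.val_succ] at e1
        rw [Fin.val_succ, Fin.val_castSucc] at e2
        omega
    · intro hr; left; rw [hr]; exact ⟨rfl, rfl⟩
  rw [hcard, Nat.cast_one, mul_one] at hflux
  exact hflux

/-- **THE LADDER'S GROUND STATE IS STRICTLY INCREASING AWAY FROM THE HOT SEAT: `c_k < c_{k+1}`** (positive solution, `ρ > 0`, `t > 0`, `K ≥ 1`). [ours] -/
theorem ladder_strictMono_step (hK : 1 ≤ K) (ht : 0 < t) (hρ : 0 < ρ) (hc : ∀ k, 0 < c k)
    (hvertex : ∀ i : Fin (K + 1), t / K * ∑ r : Fin K, ((if i = ((fun j : Fin K => ((j.castSucc, j.succ) : Fin (K + 1) × Fin (K + 1))) r).1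
        then c ((fun j : Fin K => ((j.castSucc, j.succ) : Fin (K + 1) × Fin (K + 1))) r).2 - c ((fun j : Fin K => ((j.castSucc, j.succ) : Fin (K + 1) × Fin (K + 1))) r).1 else 0)
      + (if i = ((fun j : Fin K => ((j.castSucc, j.succ) : Fin (K + 1) × Fin (K + 1))) r).2
        then c ((fun j : Fin K => ((j.castSucc, j.succ) : Fin (K + 1) × Fin (K + 1))) r).1 - c ((fun j : Fin K => ((j.castSucc, j.succ) : Fin (K + 1) × Fin (K + 1))) r).2 else 0))
      - (if i = 0 then h * c i else 0) = -ρ * c i) (k : Fin K) :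
    c k.castSucc < c k.succ := by
  classical
  have hKpos : (0 : ℝ) < K := Nat.cast_pos.mpr (by omega)
  have hinc := ladder_increment_eq hvertex k
  have hA : 0 < ∑ i ∈ univ.filter (fun i : Fin (K + 1) => k.succ ≤ i), c i :=
    lt_of_lt_of_le (hc k.succ) (Finset.single_le_sum (fun i _ => (hc i).le) (by rw [mem_filter]; exact ⟨mem_univ _, le_rfl⟩))
  have : 0 < t / K * (c k.succ - c k.castSucc) := by rw [hinc]; exact mul_pos hρ hA
  have htK : 0 < t / K := div_pos ht hKpos
  nlinarith

/-- **CONCAVITY: the increments do not increase along the ladder** — `c_{k'+1} − c_{k'} ≤ c_{k+1} − c_k` for `k ≤ k'` (positive solution, `ρ ≥ 0`, `t > 0`, `K ≥ 1`). [ours] -/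
theorem ladder_increment_antitone (hK : 1 ≤ K) (ht : 0 < t) (hρ : 0 ≤ ρ) (hc : ∀ k, 0 < c k)
    (hvertex : ∀ i : Fin (K + 1), t / K * ∑ r : Fin K, ((if i = ((fun j : Fin K => ((j.castSucc, j.succ) : Fin (K + 1) × Fin (K + 1))) r).1
        then c ((fun j : Fin K => ((j.castSucc, j.succ) : Fin (K + 1) × Fin (K + 1))) r).2 - c ((fun j : Fin K => ((j.castSucc, j.succ) : Fin (K + 1) × Fin (K + 1))) r).1 else 0)
      + (if i = ((fun j : Fin K => ((j.castSucc, j.succ) : Fin (K + 1) × Fin (K + 1))) r).2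
        then c ((fun j : Fin K => ((j.castSucc, j.succ) : Fin (K + 1) × Fin (K + 1))) r).1 - c ((fun j : Fin K => ((j.castSucc, j.succ) : Fin (K + 1) × Fin (K + 1))) r).2 else 0))
      - (if i = 0 then h * c i else 0) = -ρ * c i) {k k' : Fin K} (hkk : k ≤ k') :
    c k'.succ - c k'.castSucc ≤ c k.succ - c k.castSucc := by
  classical
  have hKpos : (0 : ℝ) < K := Nat.cast_pos.mpr (by omega)
  have h1 := ladder_increment_eq hvertex k
  have h2 := ladder_increment_eq hvertex k'
  -- the tails are nested
  have hsub : univ.filter (fun i : Fin (K + 1) => k'.succ ≤ i) ⊆ univ.filter (fun i : Fin (K + 1) => k.succ ≤ i) := by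
    intro i hi
    rw [mem_filter] at hi ⊢
    exact ⟨mem_univ _, le_trans (Fin.succ_le_succ_iff.mpr hkk) hi.2⟩
  have htails : ∑ i ∈ univ.filter (fun i : Fin (K + 1) => k'.succ ≤ i), c i ≤ ∑ i ∈ univ.filter (fun i : Fin (K + 1) => k.succ ≤ i), c i :=
    sum_le_sum_of_subset_of_nonneg hsub fun i _ _ => (hc i).le
  have htK : 0 < t / K := div_pos ht hKpos
  have : t / K * (c k'.succ - c k'.castSucc) ≤ t / K * (c k.succ - c k.castSucc) := by
    rw [h1, h2]; exact mul_le_mul_of_nonneg_left htails hρ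
  exact le_of_mul_le_mul_left this htK

/-- **THE FIRST INCREMENT IS EXACT: `c_1 − c_0 = (K/t)·(h − ρ)·c_0`** (trace identity; `K ≥ 1`, `t > 0`). [ours] -/
theorem ladder_first_increment (hK : 1 ≤ K) (ht : 0 < t)
    (hvertex : ∀ i : Fin (K + 1), t / K * ∑ r : Fin K, ((if i = ((fun j : Fin K => ((j.castSucc, j.succ) : Fin (K + 1) × Fin (K + 1))) r).1
        then c ((fun j : Fin K => ((j.castSucc, j.succ) : Fin (K + 1) × Fin (K + 1))) r).2 - c ((fun j : Fin K => ((j.castSucc, j.succ) : Fin (K + 1) × Fin (K + 1))) r).1 else 0)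
      + (if i = ((fun j : Fin K => ((j.castSucc, j.succ) : Fin (K + 1) × Fin (K + 1))) r).2
        then c ((fun j : Fin K => ((j.castSucc, j.succ) : Fin (K + 1) × Fin (K + 1))) r).1 - c ((fun j : Fin K => ((j.castSucc, j.succ) : Fin (K + 1) × Fin (K + 1))) r).2 else 0))
      - (if i = 0 then h * c i else 0) = -ρ * c i) :
    c (⟨0, hK⟩ : Fin K).succ - c 0 = K / t * ((h - ρ) * c 0) := by
  classical
  have hKpos : (0 : ℝ) < K := Nat.cast_pos.mpr (by omega)
  have hinc := ladder_increment_eq hvertex ⟨0, hK⟩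
  have htr := groundState_trace (fun j : Fin K => ((j.castSucc, j.succ) : Fin (K + 1) × Fin (K + 1))) hvertex
  -- the tail `{i ≥ 1}` is everything but `0`
  have htail : ∑ i ∈ univ.filter (fun i : Fin (K + 1) => (⟨0, hK⟩ : Fin K).succ ≤ i), c i = (∑ i : Fin (K + 1), c i) - c 0 := by
    have hset : univ.filter (fun i : Fin (K + 1) => (⟨0, hK⟩ : Fin K).succ ≤ i) = univ.erase 0 := by
      ext i
      simp only [mem_filter, mem_univ, true_and, mem_erase, ne_eq, and_true, Fin.le_def, Fin.val_succ, Fin.ext_iff, Fin.val_zero]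
      omega
    rw [hset, sum_erase_eq_sub (mem_univ _)]
  have hcs : ((⟨0, hK⟩ : Fin K).castSucc : Fin (K + 1)) = 0 := rfl
  rw [htail, hcs, mul_sub ρ (∑ i : Fin (K + 1), c i) (c 0), htr] at hinc
  -- `(t/K)(c_1 − c_0) = hc_0 − ρc_0`
  have htK : t / K ≠ 0 := (div_pos ht hKpos).ne'
  calc c (⟨0, hK⟩ : Fin K).succ - c 0 = K / t * (t / K * (c (⟨0, hK⟩ : Fin K).succ - c 0)) := by field_simp
    _ = K / t * (h * c 0 - ρ * c 0) := by rw [hinc]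
    _ = K / t * ((h - ρ) * c 0) := by ring

/-- **THE LINEAR ENVELOPE WITH THE EXACT FIRST STEP: `c_k ≤ (1 + k·K(h−ρ)/t)·c_0`** along the ladder (positive solution, `ρ ≥ 0`, `t > 0`, `K ≥ 1`). [ours] -/
theorem ladder_le_linear (hK : 1 ≤ K) (ht : 0 < t) (hρ : 0 ≤ ρ) (hc : ∀ k, 0 < c k)
    (hvertex : ∀ i : Fin (K + 1), t / K * ∑ r : Fin K, ((if i = ((fun j : Fin K => ((j.castSucc, j.succ) : Fin (K + 1) × Fin (K + 1))) r).1
        then c ((fun j : Fin K => ((j.castSucc, j.succ) : Fin (K + 1) × Fin (K + 1))) r).2 - c ((fun j : Fin K => ((j.castSucc, j.succ) : Fin (K + 1) × Fin (K + 1))) r).1 else 0)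
      + (if i = ((fun j : Fin K => ((j.castSucc, j.succ) : Fin (K + 1) × Fin (K + 1))) r).2
        then c ((fun j : Fin K => ((j.castSucc, j.succ) : Fin (K + 1) × Fin (K + 1))) r).1 - c ((fun j : Fin K => ((j.castSucc, j.succ) : Fin (K + 1) × Fin (K + 1))) r).2 else 0))
      - (if i = 0 then h * c i else 0) = -ρ * c i) :
    ∀ k : Fin (K + 1), c k ≤ (1 + (k : ℝ) * ((K : ℝ) * (h - ρ) / t)) * c 0 := by
  intro k
  induction k using Fin.induction with
  | zero => simp
  | succ j ih =>
    have hstep : c j.succ - c j.castSucc ≤ K / t * ((h - ρ) * c 0) := by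
      rw [← ladder_first_increment hK ht hvertex]
      exact ladder_increment_antitone hK ht hρ hc hvertex (Fin.le_def.mpr (Nat.zero_le _))
    have hcoe : ((j.succ : Fin (K + 1)) : ℝ) = (j.castSucc : Fin (K + 1)) + 1 := by
      rw [Fin.val_succ, Fin.val_castSucc]; push_cast; ring
    rw [hcoe]
    have : K / t * ((h - ρ) * c 0) = ((K : ℝ) * (h - ρ) / t) * c 0 := by ring
    rw [this] at hstep
    nlinarith [ih, hstep]

end Ladder

end Summit.Ventures.LatticeQCDFlow.Scaling

end
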